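import Summits.CriticalPhenomena.PercolationContinuityZ3.Theorems.PercNearOneGluingNoHeavyLowerTailQuantitativeS5RankGain
import Summits.CriticalPhenomena.PercolationContinuityZ3.Theorems.PercNearOneGluingAdditiveGluingGenOfSurplusTransfer
import HarnessLib

/-!
# Quantitative (GEN) in the Sur-form: `Sur_o(A) ≥ Σ_{a ∈ A} γ_a · μ(o ∈ C_a | a ↮ A∖a)`

Support file (`--supports stmt-CriticalPhenomena-4575`), prover seat `prim-rate-mine-2` (lane prim-rate, constants-miner (c), BENCH row
M2-R4).  No definitions, no named facts, no sorries; standard axioms.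

The tree's (GEN) `Sur_o(A) ≥ 0` (`AGloc.gen_firstRank_of_surplusTransfer`, paper Thm 4.5) peels the rank-maximal relay `k` with the
van den Berg–Häggström–Kahn one-cluster inequality and then uses (S5) for `A' = A∖k` with second observer `k`.  Keeping the two discarded
nonnegative quantities — the rank gain `γ_k = Sur_k(A') − κ_k` of Lemma κ, and the rank gains INSIDE (S5) (the lane's quantitative (S5),
`CSH.surplusTransfer_ge_sum_rankGain`) — gives, for non-degenerate weights, `o ∉ A`, monotone `F` and an injective compatible rank,

  `Σ_{a ∈ A} rankGain w A r F a · avoidConst w a (A∖a) o ≤ surplus w A r F o`      (`CSH.surplus_ge_sum_rankGain`),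

i.e. `Sur_o(A) ≥ Σ_a γ_a·φ_a` with Kozma–Nitzan's detachment constants `φ_a = μ(o ∈ C_a | a ↮ A∖a)`.  Constant 1 is attained (lane census,
exact, n ≤ 5: 0 violations in 89 892 instances, min slack 0); the neighbouring shapes `Σ_{a≠c}(m_a − m_c)φ_a ≤ Sur_o(A)` (the pre-FKG Q-KN
shape) and the coefficient `μ(o ∈ C_{x_s} | x_s ↮ T_{<s})` are FALSE for `Sur` (exact 5-vertex witnesses in the lane census).
[cite: KozmaNitzan2024, Conj. 4 (p. 32), Lemma 2 (p. 6)] [cite: VandenbergHaggstromKahn2005, Thm. 1.3 (p. 6)]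
-/

noncomputable section

namespace Summit.CriticalPhenomena.PercolationContinuityZ3.Theorems

open MeasureTheory Set Literature.Probability.LatticeModels Literature.Probability.Percolation
open scoped Classical
open KNPreFKG

namespace CSH

variable {n : ℕ}

/-- **Quantitative (GEN), Sur-form.**  Non-degenerate weights, `o ∉ A`, monotone `F`, injective compatible rank `r`:
`Σ_{a ∈ A} rankGain w A r F a · μ(o ∈ C_a | a ↮ A∖a) ≤ Sur_o(A)`.  One vdBHK peel of the rank-maximal relay `k` (as in
`AGloc.gen_firstRank_of_surplusTransfer`) on top of the quantitative (S5) `CSH.surplusTransfer_ge_sum_rankGain` for `A∖k` with second observer `k`.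
[cite: KozmaNitzan2024, Conj. 4 (p. 32)] [cite: VandenbergHaggstromKahn2005, Thm. 1.3 (p. 6)] -/
theorem surplus_ge_sum_rankGain (w : Sym2 (Fin n) → unitInterval) (hw : ∀ e, 0 < w e ∧ w e < 1)
    (A : Finset (Fin n)) (o : Fin n) (F : Set (Fin n) → ℝ) (r : Fin n → ℕ)
    (hF : ∀ S S' : Set (Fin n), S ⊆ S' → F S ≤ F S') (hr : Set.InjOn r ↑A)
    (hcompat : ∀ a ∈ A, ∀ a' ∈ A, r a < r a' →
      ∫ ω, F (openCluster ω a) ∂(prodBernoulli w) ≤ ∫ ω, F (openCluster ω a') ∂(prodBernoulli w))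
    (hoA : o ∉ A) :
    ∑ a ∈ A, rankGain w A r F a * avoidConst w a (↑(A.erase a) : Set (Fin n)) o ≤ surplus w A r F o := by
  classical
  set μ := prodBernoulli w with hμ
  have hmeas : ∀ S : Set (BondConfig (Fin n)), MeasurableSet S := fun _ => MeasurableSet.of_discrete
  have hint : ∀ (g : BondConfig (Fin n) → ℝ) (S : Set (BondConfig (Fin n))), IntegrableOn g S μ :=
    fun g S => (Integrable.of_finite).integrableOn
  have hn := fun (S : Set (BondConfig (Fin n))) => (measureReal_nonneg : 0 ≤ μ.real S)
  rcases A.eq_empty_or_nonempty with hA0 | hne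
  · subst hA0
    simp [surplus]
  -- the rank-maximal relay `k` and `T = A.erase k`
  obtain ⟨k, hkA, hkmax⟩ := Finset.exists_max_image A r hne
  set T : Finset (Fin n) := A.erase k with hT
  have hTA : ∀ a ∈ T, a ∈ A := fun a ha => Finset.mem_of_mem_erase ha
  have hkT : k ∉ T := Finset.notMem_erase k A
  have hlt : ∀ a ∈ T, r a < r k := by
    intro a ha
    rcases (hkmax a (hTA a ha)).lt_or_eq with h | h
    · exact h
    · exact absurd (hr (hTA a ha) hkA h) (Finset.ne_of_mem_erase ha)
  have hrT : Set.InjOn r ↑T := hr.mono (by intro a ha; exact hTA a ha)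
  have hcompatT : ∀ a ∈ T, ∀ a' ∈ T, r a < r a' →
      ∫ ω, F (openCluster ω a) ∂(prodBernoulli w) ≤ ∫ ω, F (openCluster ω a') ∂(prodBernoulli w) :=
    fun a ha a' ha' h => hcompat a (hTA a ha) a' (hTA a' ha') h
  have hko : o ≠ k := fun h => hoA (h ▸ hkA)
  have hoT : o ∉ T := fun h => hoA (hTA o h)
  -- quantitative (S5) for `(T; o, k)` WITH the rank gains
  have hS5k := surplusTransfer_ge_sum_rankGain w hw o k hko T r F hF hrT hcompatT hoT hkT
  set f₀ : BondConfig (Fin n) → ℝ := fun ω => F (openCluster ω o) with hf₀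
  set fk : BondConfig (Fin n) → ℝ := fun ω => F (openCluster ω k) with hfk
  set mk : ℝ := ∫ ω, fk ω ∂μ with hmk
  set UT : Set (BondConfig (Fin n)) := ⋃ a ∈ T, openConn o a with hUT
  set Ok : Set (BondConfig (Fin n)) := openConn o k with hOk
  set Dk : Set (BondConfig (Fin n)) := {ω : BondConfig (Fin n) | ∀ a ∈ T, ¬ (openGraph ω).Reachable k a} with hDk
  set pat : Fin n → Fin n → Set (BondConfig (Fin n)) := fun x a =>
    (openConn x a ∩ ⋂ a' ∈ T.filter (fun a' => r a' < r a), (openConn x a')ᶜ : Set (BondConfig (Fin n))) with hpat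
  -- patterns over `A`: for `a ∈ T` they are the `T`-patterns, for `k` it is `Ok ∩ Dk`
  have hfiltT : ∀ a ∈ T, A.filter (fun a' => r a' < r a) = T.filter (fun a' => r a' < r a) := by
    intro a ha
    rw [hT, AGloc.filter_erase_of_not]
    exact fun h => lt_asymm h (hlt a ha)
  have hfiltk : A.filter (fun a' => r a' < r k) = T := by
    ext a
    simp only [Finset.mem_filter, hT, Finset.mem_erase]
    constructor
    · rintro ⟨ha, h⟩; exact ⟨fun hak => lt_irrefl _ (hak ▸ h), ha⟩
    · rintro ⟨hak, ha⟩; exact ⟨ha, hlt a (Finset.mem_erase.2 ⟨hak, ha⟩)⟩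
  have hPk : (openConn o k ∩ ⋂ a' ∈ A.filter (fun a' => r a' < r k), (openConn o a')ᶜ : Set (BondConfig (Fin n))) = Dk ∩ Ok := by
    rw [hfiltk]
    ext ω
    simp only [hDk, hOk, mem_inter_iff, mem_iInter, mem_compl_iff, openConn, mem_setOf_eq]
    constructor
    · rintro ⟨hk', h⟩
      exact ⟨fun a ha hka => h a ha (hk'.trans hka), hk'⟩
    · rintro ⟨h, hk'⟩
      exact ⟨hk', fun a ha hoa => h a ha (hk'.symm.trans hoa)⟩
  have hsumA : ∑ a ∈ A, μ.real (openConn o a ∩ ⋂ a' ∈ A.filter (fun a' => r a' < r a), (openConn o a')ᶜ : Set (BondConfig (Fin n))) *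
        ∫ ω, F (openCluster ω a) ∂μ =
      ∑ a ∈ T, μ.real (pat o a) * ∫ ω, F (openCluster ω a) ∂μ + μ.real (Dk ∩ Ok) * mk := by
    rw [← Finset.add_sum_erase A _ hkA, hPk, add_comm]
    congr 1
    refine Finset.sum_congr rfl fun a ha => ?_
    rw [hfiltT a ha]
  -- the union over `A` splits as `UT ∪ Ok`, and `(UT ∪ Ok) \ UT = Dk ∩ Ok`
  have hUA : (⋃ a ∈ A, (openConn o a : Set (BondConfig (Fin n)))) = UT ∪ Ok := by
    ext ω
    simp only [hUT, hOk, mem_iUnion, mem_union, exists_prop, hT, Finset.mem_erase]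
    constructor
    · rintro ⟨a, ha, h⟩
      by_cases hak : a = k
      · exact Or.inr (hak ▸ h)
      · exact Or.inl ⟨a, ⟨hak, ha⟩, h⟩
    · rintro (⟨a, ⟨_, ha⟩, h⟩ | h)
      · exact ⟨a, ha, h⟩
      · exact ⟨k, hkA, h⟩
  have h0k : ∀ ω ∈ Ok, f₀ ω = fk ω := fun ω hω => by
    simp only [hf₀, hfk]; rw [openCluster_eq_of_reachable (hω : (openGraph ω).Reachable o k)]
  have hdiff : (UT ∪ Ok) \ UT = Dk ∩ Ok := by
    ext ω
    simp only [hUT, hOk, hDk, mem_sdiff, mem_union, mem_iUnion, mem_inter_iff, exists_prop, not_exists, not_and, openConn,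
      mem_setOf_eq]
    constructor
    · rintro ⟨h | h, hno⟩
      · obtain ⟨a, ha, h'⟩ := h; exact absurd h' (hno a ha)
      · exact ⟨fun a ha hka => hno a ha (h.trans hka), h⟩
    · rintro ⟨hd, hk'⟩
      exact ⟨Or.inr hk', fun a ha hoa => hd a ha (hk'.symm.trans hoa)⟩
  have hsplit : ∫ ω in UT ∪ Ok, f₀ ω ∂μ = ∫ ω in UT, f₀ ω ∂μ + ∫ ω in Dk ∩ Ok, fk ω ∂μ := by
    rw [← integral_inter_add_sdiff (hmeas UT) (hint f₀ (UT ∪ Ok)), inter_eq_right.2 subset_union_left, hdiff,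
      setIntegral_congr_fun (hmeas (Dk ∩ Ok)) fun ω hω => h0k ω hω.2]
  -- one-cluster BHK for `C(k)` given `k ↮ T`
  have hindk : ∀ ω : BondConfig (Fin n), (connFamily k o).indicator (1 : Set (Sym2 (Fin n)) → ℝ) (openEdgeCluster ω k) =
      Ok.indicator (1 : BondConfig (Fin n) → ℝ) ω := fun ω => by
    rw [congrFun (indicator_comp_openEdgeCluster (connFamily k o) k) ω, ← openConn_eq_setOf_connFamily, openConn_symm k o]
  have hprod : ∀ (S : Set (BondConfig (Fin n))) (g : BondConfig (Fin n) → ℝ),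
      ∫ ω in Dk, S.indicator (1 : BondConfig (Fin n) → ℝ) ω * g ω ∂μ = ∫ ω in Dk ∩ S, g ω ∂μ := by
    intro S g
    rw [← setIntegral_mul_indicator_one μ Dk S g]
    refine setIntegral_congr_fun (hmeas Dk) fun ω _ => ?_
    ring
  have hDset : {ω : BondConfig (Fin n) | ∀ x ∈ (↑T : Set (Fin n)), ¬ (openGraph ω).Reachable k x} = Dk := by
    ext ω; simp [hDk]
  have hBHK := BHK2006_clusterConditionalPositiveAssociation_holds (Fin n) w k (↑T : Set (Fin n))
    ((connFamily k o).indicator 1) (fun C => F {a | a = k ∨ ∃ e ∈ C, a ∈ e})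
    (monotone_indicator_one_of_isUpperSet (isUpperSet_connFamily k o)) (monotone_clusterFun k F hF)
    (by exact_mod_cast hkT)
  simp only [hDset, clusterFun_openEdgeCluster, hindk] at hBHK
  rw [setIntegral_indicator_one_eq, hprod Ok] at hBHK
  change μ.real (Dk ∩ Ok) * ∫ ω in Dk, fk ω ∂μ ≤ μ.real Dk * ∫ ω in Dk ∩ Ok, fk ω ∂μ at hBHK
  -- the rank gain of `k`: `γ_k = Sur_k(T) − κ_k`
  have hγk : rankGain w A r F k = surplus w T r F k - (mk * μ.real Dk - ∫ ω in Dk, fk ω ∂μ) := by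
    rw [rankGain_top_eq w A r F k hkA hr hkmax, ← hT, hDset]
  -- positivity of `μ(Dk)` (non-degenerate weights)
  have hempty : (∅ : BondConfig (Fin n)) ∈ Dk := by
    intro a ha h
    rw [HullPort.reachable_empty_iff] at h
    exact hkT (h ▸ ha)
  have hDkpos : 0 < μ.real Dk := prodBernoulli_real_pos_of_nonempty hw ⟨∅, hempty⟩
  -- rewrite the quantitative (S5) in the present notation
  have hDset' : {ω : BondConfig (Fin n) | ∀ a ∈ (↑T : Set (Fin n)), ¬ (openGraph ω).Reachable k a} = Dk := hDset
  rw [hDset'] at hS5k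
  change μ.real Dk * (∑ a ∈ T, rankGain w T r F a * avoidConst w a ((↑(T.erase a) : Set (Fin n)) ∪ {k}) o) +
      μ.real (Dk ∩ Ok) * (∫ ω in (⋃ a ∈ T, openConn k a), fk ω ∂μ - ∑ a ∈ T, μ.real (pat k a) * ∫ ω, F (openCluster ω a) ∂μ) ≤
    μ.real Dk * (∫ ω in UT, f₀ ω ∂μ - ∑ a ∈ T, μ.real (pat o a) * ∫ ω, F (openCluster ω a) ∂μ) at hS5k
  -- identify the `T`-part of the target sum
  have hsumT : ∑ a ∈ T, rankGain w T r F a * avoidConst w a ((↑(T.erase a) : Set (Fin n)) ∪ {k}) o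
      = ∑ a ∈ T, rankGain w A r F a * avoidConst w a (↑(A.erase a) : Set (Fin n)) o := by
    refine Finset.sum_congr rfl fun a ha => ?_
    have hak : a ≠ k := Finset.ne_of_mem_erase ha
    have hset : (↑(T.erase a) : Set (Fin n)) ∪ {k} = (↑(A.erase a) : Set (Fin n)) := by
      ext b
      simp only [mem_union, Finset.mem_coe, hT, Finset.mem_erase, mem_singleton_iff]
      constructor
      · rintro (⟨hba, _, hbA⟩ | rfl)
        · exact ⟨hba, hbA⟩
        · exact ⟨hak.symm, hkA⟩
      · rintro ⟨hba, hbA⟩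
        by_cases hbk : b = k
        · exact Or.inr hbk
        · exact Or.inl ⟨hba, hbk, hbA⟩
    rw [rankGain_erase_top w A r F k a ha hkmax hr hkA, hset]
  -- the `k`-term: `avoidConst w k ↑(A.erase k) o = μ(Dk ∩ Ok)/μ(Dk)`
  have hqk : avoidConst w k (↑(A.erase k) : Set (Fin n)) o = μ.real (Dk ∩ Ok) / μ.real Dk := by
    simp only [avoidConst, ← hT, hDset, hOk, openConn_symm k o, hμ]
  -- assemble
  have hsurA : surplus w A r F o = (∫ ω in UT, f₀ ω ∂μ + ∫ ω in Dk ∩ Ok, fk ω ∂μ)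
      - (∑ a ∈ T, μ.real (pat o a) * ∫ ω, F (openCluster ω a) ∂μ + μ.real (Dk ∩ Ok) * mk) := by
    unfold surplus
    rw [hsumA, hUA, hsplit]
  have hsurkT : surplus w T r F k = ∫ ω in (⋃ a ∈ T, openConn k a), fk ω ∂μ - ∑ a ∈ T, μ.real (pat k a) * ∫ ω, F (openCluster ω a) ∂μ := by
    rfl
  rw [← Finset.add_sum_erase A _ hkA, ← hT, ← hsumT, hqk, hsurA, hγk]
  -- multiply through by `μ(Dk) > 0`
  rw [← mul_le_mul_iff_of_pos_left hDkpos]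
  have e1 : μ.real Dk * (surplus w T r F k - (mk * μ.real Dk - ∫ ω in Dk, fk ω ∂μ)) * (μ.real (Dk ∩ Ok) / μ.real Dk)
      = μ.real (Dk ∩ Ok) * surplus w T r F k - μ.real (Dk ∩ Ok) * (mk * μ.real Dk - ∫ ω in Dk, fk ω ∂μ) := by
    field_simp
  rw [mul_add, ← mul_assoc, e1, hsurkT]
  linarith [hS5k, hBHK]

end CSH

end Summit.CriticalPhenomena.PercolationContinuityZ3.Theorems
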